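import Summits.HodgeConjecture.HodgeConjecture.Theorems.Ring2WeilCoverageWeilGramLevel24SqrtNegTwoThree
import HarnessLib

/-!
# Weil-type family coverage — THE COMPONENTS OF THE WEIL-TYPE `ℤ[ζ₂₄]`-FOURFOLDS, III: `K_d = ℚ(√−6)`
# (`s₆ = (ζ³ + ζ⁹)(ζ² + ζ²²) = √−2·√3`): principal-type Gram determinant `576 = 24²` — SPLIT, right sign: row W4.6.1

research route conditional on HC_CM; not a corollary; Q11.4-sentence-2 already refuted in dim ≥ 3.

Ring 2, WEIL-TYPE FAMILY-COVERAGE CENSUS (`HOME/WEIL-FAMILY-COVERAGE.md` `## b01`, block b01.46 (C2)), part 91 of the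
`Ring2WeilCoverage*` series; continues parts 89/90 (frame `θ^i`, `ξ = ζ³/Φ₂₄′(ζ)`, `s₂ = ζ³ + ζ⁹`).

* §0 `r₃ = ζ² + ζ²²` (`= ζ₁₂ + ζ₁₂¹¹ = √3`) is real with `r₃² = 3`; `s₆ = s₂ r₃` is skew with `s₆² = −6`: `ℚ(s₆) = ℚ(√−6)`,
  the fourth imaginary quadratic subfield of `ℚ(ζ₂₄)`.
* §1 `(E_ξ, s₆)`: **`a = −(0,2,0,10 / 2,0,10,0 / 0,10,0,38 / 10,0,38,0)`, `det a = 576`**; §2 EVERY skew `ζ′` of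
  principal type gives `576` (THEOREM L (i) at `24`); such `Φ`-positive `ζ′` exist on every `ℚ(√−6)`-balanced `Φ` (part 75
  `exists_principal_twentyFour_sqrt_neg_six`); class **`[576] = [1]`** = SPLIT, right sign — row W4.6.1.

HONEST FRAMING as parts 82–90; `HC_CM` is used nowhere.  No `def`, no named fact, no `sorry`.  Certificates from
`work/py/gen24.py`, re-verified by `linear_combination`.

References: [cite: vanGeemen1994HodgeAV, Lemma 5.2 (2)–(4), 5.4 and (5.4.1)]; [cite: Shimura1998, §14.3 Prop. 4–5,
pp. 103–104]; census b01.46 (C2) (seat-derived).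
-/

noncomputable section

open Polynomial NumberField Module
open scoped nonZeroDivisors

namespace Summit.HodgeConjecture.Ring2WeilCoverage.WeilGramLevel24SqrtNegSix

open Literature.AlgebraicGeometry.VanGeemen1994 (weilField weilNormResidueGroup)
open Literature.AlgebraicGeometry.Motives (normUnitsSubgroup)
open Literature.NumberTheory.ComplexMultiplication
open Summit.HodgeConjecture.Ring2WeilCoverage.TraceGramDeterminant (trace_aeval_zeta_mul_inv)
open Summit.HodgeConjecture.Ring2WeilCoverage.WeilGramCMPoint
open Summit.HodgeConjecture.Ring2WeilCoverage.RealUnitNormHalfSystems (complexConj_eq_inv)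
open Summit.HodgeConjecture.Ring2WeilCoverage.CyclotomicPrincipalObstruction (complexConj_xi)
open Summit.HodgeConjecture.Ring2WeilCoverage.CyclotomicDifferent (isOfType_one_xi_top xi_ne_zero)
open Summit.HodgeConjecture.Ring2WeilCoverage.RealUnitNormAllLevels (norm_realUnits_pos_twentyFour)
open Summit.HodgeConjecture.HodgeConjecture.Ring2.WeilCoverage (mk_eq_split_of_even mem_normUnitsSubgroup_of_sq_add_mul_sq)
open Summit.HodgeConjecture.HodgeConjecture.Ring2.Hypotheses (splitDiscriminantClass)
open Summit.HodgeConjecture.Ring2WeilCoverage.WeilGramLevel24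
open Summit.HodgeConjecture.Ring2WeilCoverage.WeilGramLevel24SqrtNegTwoThree
variable {K : Type} [Field K] [NumberField K] {ζ : K}

/-! ### §0 `s₆ = s₂·r₃`, `r₃ = ζ² + ζ²² = √3` -/

/-- `r₃ = ζ² + ζ²²` is real. [folklore] -/
theorem complexConj_sqrtThree [IsCMField K] (hζ : IsPrimitiveRoot ζ 24) :
    IsCMField.complexConj K (ζ ^ 2 + ζ ^ 22) = ζ ^ 2 + ζ ^ 22 := by
  rw [map_add, map_pow, map_pow, complexConj_eq_inv hζ, inv_pow_eq_pow hζ (show 2 + 22 = 24 by norm_num),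
    inv_pow_eq_pow hζ (show 22 + 2 = 24 by norm_num), add_comm (ζ ^ 22)]

omit [NumberField K] in
/-- `r₃² = 3`. [folklore] -/
theorem sq_sqrtThree (hζ : IsPrimitiveRoot ζ 24) : (ζ ^ 2 + ζ ^ 22) ^ 2 = 3 := by
  have h24 : ζ ^ 24 = 1 := hζ.pow_eq_one
  linear_combination (-1 + ζ ^ 8 + ζ ^ 12) * cyc_twentyFour hζ + (2 + ζ ^ 20) * h24

omit [NumberField K] in
/-- **`s₆² = −6`** for `s₆ = (ζ³ + ζ⁹)(ζ² + ζ²²)`. [folklore] -/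
theorem sq_sqrtNegSix (hζ : IsPrimitiveRoot ζ 24) : ((ζ ^ 3 + ζ ^ 9) * (ζ ^ 2 + ζ ^ 22)) ^ 2 = -6 := by
  rw [mul_pow, sq_sqrtNegTwo hζ, sq_sqrtThree hζ]; norm_num

/-- **`s₆` is skew.** [folklore] -/
theorem complexConj_sqrtNegSix [IsCMField K] (hζ : IsPrimitiveRoot ζ 24) :
    IsCMField.complexConj K ((ζ ^ 3 + ζ ^ 9) * (ζ ^ 2 + ζ ^ 22)) = -((ζ ^ 3 + ζ ^ 9) * (ζ ^ 2 + ζ ^ 22)) := by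
  rw [map_mul, complexConj_sqrtNegTwo hζ, complexConj_sqrtThree hζ, neg_mul]

/-! ### §1 The principal-type form for `K_d = ℚ(√−6)`: `det = 576` -/

/-- `Tr(ζ′sθ^0) = 0` for `ζ′ = ξ = ζ³/Φ′(ζ)`, `s = √−6 = (ζ³ + ζ⁹)(ζ² + ζ²²)`, `θ = ζ + ζ⁻¹` (Euler evaluation). research route conditional on HC_CM; not a corollary; Q11.4-sentence-2 already refuted in dim ≥ 3. [folklore] -/
theorem trace_xi_sqrtNegSix_zero [IsCyclotomicExtension {24} ℚ K] (hζ : IsPrimitiveRoot ζ 24) :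
    Algebra.trace ℚ K ((ζ ^ 3 * (aeval ζ (derivative (cyclotomic 24 ℚ)))⁻¹) * ((ζ ^ 3 + ζ ^ 9) * (ζ ^ 2 + ζ ^ 22))) = 0 := by
  have h24 : ζ ^ 24 = 1 := hζ.pow_eq_one
  have hΦ := cyc_twentyFour hζ
  rw [trace_of_key₀ hζ (C (-1 : ℚ) + C (0 : ℚ) * X + C (-2 : ℚ) * X ^ 2 + C (0 : ℚ) * X ^ 3 + C (2 : ℚ) * X ^ 4 +
      C (0 : ℚ) * X ^ 5 + C (1 : ℚ) * X ^ 6 + C (0 : ℚ) * X ^ 7) (by compute_degree) (by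
    rw [aeval_poly₈]
    push_cast
    linear_combination ((aeval ζ (derivative (cyclotomic 24 ℚ)))⁻¹ * (1 + 2 * ζ^2 + ζ^6)) * hΦ +
      ((aeval ζ (derivative (cyclotomic 24 ℚ)))⁻¹ * (ζ^4 + ζ^10)) * h24)]
  norm_num [coeff_X_pow, coeff_X, coeff_C, coeff_one]

/-- `Tr(ζ′sθ^1) = 2` for `ζ′ = ξ = ζ³/Φ′(ζ)`, `s = √−6 = (ζ³ + ζ⁹)(ζ² + ζ²²)`, `θ = ζ + ζ⁻¹` (Euler evaluation). research route conditional on HC_CM; not a corollary; Q11.4-sentence-2 already refuted in dim ≥ 3. [folklore] -/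
theorem trace_xi_sqrtNegSix_one [IsCyclotomicExtension {24} ℚ K] (hζ : IsPrimitiveRoot ζ 24) :
    Algebra.trace ℚ K ((ζ ^ 3 * (aeval ζ (derivative (cyclotomic 24 ℚ)))⁻¹) * ((ζ ^ 3 + ζ ^ 9) * (ζ ^ 2 + ζ ^ 22)) * (ζ + ζ⁻¹)) = 2 := by
  have h24 : ζ ^ 24 = 1 := hζ.pow_eq_one
  have hΦ := cyc_twentyFour hζ
  rw [trace_of_key₁ hζ (C (0 : ℚ) + C (-3 : ℚ) * X + C (0 : ℚ) * X ^ 2 + C (-1 : ℚ) * X ^ 3 + C (0 : ℚ) * X ^ 4 +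
      C (3 : ℚ) * X ^ 5 + C (0 : ℚ) * X ^ 6 + C (2 : ℚ) * X ^ 7) (by compute_degree) (by
    rw [aeval_poly₈]
    push_cast
    linear_combination ((aeval ζ (derivative (cyclotomic 24 ℚ)))⁻¹ * (3 * ζ^2 + 2 * ζ^4 + ζ^6 + ζ^8)) * hΦ +
      ((aeval ζ (derivative (cyclotomic 24 ℚ)))⁻¹ * (ζ^4 + ζ^6 + ζ^10 + ζ^12)) * h24)]
  norm_num [coeff_X_pow, coeff_X, coeff_C, coeff_one]

/-- `Tr(ζ′sθ^2) = 0` for `ζ′ = ξ = ζ³/Φ′(ζ)`, `s = √−6 = (ζ³ + ζ⁹)(ζ² + ζ²²)`, `θ = ζ + ζ⁻¹` (Euler evaluation). research route conditional on HC_CM; not a corollary; Q11.4-sentence-2 already refuted in dim ≥ 3. [folklore] -/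
theorem trace_xi_sqrtNegSix_two [IsCyclotomicExtension {24} ℚ K] (hζ : IsPrimitiveRoot ζ 24) :
    Algebra.trace ℚ K ((ζ ^ 3 * (aeval ζ (derivative (cyclotomic 24 ℚ)))⁻¹) * ((ζ ^ 3 + ζ ^ 9) * (ζ ^ 2 + ζ ^ 22)) * (ζ + ζ⁻¹) ^ 2) = 0 := by
  have h24 : ζ ^ 24 = 1 := hζ.pow_eq_one
  have hΦ := cyc_twentyFour hζ
  rw [trace_of_key hζ (C (-5 : ℚ) + C (0 : ℚ) * X + C (-4 : ℚ) * X ^ 2 + C (0 : ℚ) * X ^ 3 + C (4 : ℚ) * X ^ 4 +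
      C (0 : ℚ) * X ^ 5 + C (5 : ℚ) * X ^ 6 + C (0 : ℚ) * X ^ 7) (by compute_degree) (by
    rw [aeval_poly₈]
    push_cast
    linear_combination ((aeval ζ (derivative (cyclotomic 24 ℚ)))⁻¹ * (5 * ζ^2 + 5 * ζ^4 + 3 * ζ^6 + 2 * ζ^8 + ζ^10)) * hΦ +
      ((aeval ζ (derivative (cyclotomic 24 ℚ)))⁻¹ * (ζ^4 + 2 * ζ^6 + ζ^8 + ζ^10 + 2 * ζ^12 + ζ^14)) * h24)]
  norm_num [coeff_X_pow, coeff_X, coeff_C, coeff_one]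

/-- `Tr(ζ′sθ^3) = 10` for `ζ′ = ξ = ζ³/Φ′(ζ)`, `s = √−6 = (ζ³ + ζ⁹)(ζ² + ζ²²)`, `θ = ζ + ζ⁻¹` (Euler evaluation). research route conditional on HC_CM; not a corollary; Q11.4-sentence-2 already refuted in dim ≥ 3. [folklore] -/
theorem trace_xi_sqrtNegSix_three [IsCyclotomicExtension {24} ℚ K] (hζ : IsPrimitiveRoot ζ 24) :
    Algebra.trace ℚ K ((ζ ^ 3 * (aeval ζ (derivative (cyclotomic 24 ℚ)))⁻¹) * ((ζ ^ 3 + ζ ^ 9) * (ζ ^ 2 + ζ ^ 22)) * (ζ + ζ⁻¹) ^ 3) = 10 := by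
  have h24 : ζ ^ 24 = 1 := hζ.pow_eq_one
  have hΦ := cyc_twentyFour hζ
  rw [trace_of_key hζ (C (0 : ℚ) + C (-9 : ℚ) * X + C (0 : ℚ) * X ^ 2 + C (-5 : ℚ) * X ^ 3 + C (0 : ℚ) * X ^ 4 +
      C (9 : ℚ) * X ^ 5 + C (0 : ℚ) * X ^ 6 + C (10 : ℚ) * X ^ 7) (by compute_degree) (by
    rw [aeval_poly₈]
    push_cast
    linear_combination ((aeval ζ (derivative (cyclotomic 24 ℚ)))⁻¹ * (10 * ζ^4 + 8 * ζ^6 + 5 * ζ^8 + 3 * ζ^10 + ζ^12)) * hΦ +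
      ((aeval ζ (derivative (cyclotomic 24 ℚ)))⁻¹ * (ζ^4 + 3 * ζ^6 + 3 * ζ^8 + 2 * ζ^10 + 3 * ζ^12 + 3 * ζ^14 +
        ζ^16)) * h24)]
  norm_num [coeff_X_pow, coeff_X, coeff_C, coeff_one]

/-- `Tr(ζ′sθ^4) = 0` for `ζ′ = ξ = ζ³/Φ′(ζ)`, `s = √−6 = (ζ³ + ζ⁹)(ζ² + ζ²²)`, `θ = ζ + ζ⁻¹` (Euler evaluation). research route conditional on HC_CM; not a corollary; Q11.4-sentence-2 already refuted in dim ≥ 3. [folklore] -/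
theorem trace_xi_sqrtNegSix_four [IsCyclotomicExtension {24} ℚ K] (hζ : IsPrimitiveRoot ζ 24) :
    Algebra.trace ℚ K ((ζ ^ 3 * (aeval ζ (derivative (cyclotomic 24 ℚ)))⁻¹) * ((ζ ^ 3 + ζ ^ 9) * (ζ ^ 2 + ζ ^ 22)) * (ζ + ζ⁻¹) ^ 4) = 0 := by
  have h24 : ζ ^ 24 = 1 := hζ.pow_eq_one
  have hΦ := cyc_twentyFour hζ
  rw [trace_of_key hζ (C (-19 : ℚ) + C (0 : ℚ) * X + C (-14 : ℚ) * X ^ 2 + C (0 : ℚ) * X ^ 3 + C (14 : ℚ) * X ^ 4 +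
      C (0 : ℚ) * X ^ 5 + C (19 : ℚ) * X ^ 6 + C (0 : ℚ) * X ^ 7) (by compute_degree) (by
    rw [aeval_poly₈]
    push_cast
    linear_combination ((aeval ζ (derivative (cyclotomic 24 ℚ)))⁻¹ * (20 * ζ^4 + 18 * ζ^6 + 13 * ζ^8 + 8 * ζ^10 + 4 * ζ^12 +
        ζ^14)) * hΦ +
      ((aeval ζ (derivative (cyclotomic 24 ℚ)))⁻¹ * (ζ^4 + 4 * ζ^6 + 6 * ζ^8 + 5 * ζ^10 + 5 * ζ^12 + 6 * ζ^14 +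
        4 * ζ^16 + ζ^18)) * h24)]
  norm_num [coeff_X_pow, coeff_X, coeff_C, coeff_one]

/-- `Tr(ζ′sθ^5) = 38` for `ζ′ = ξ = ζ³/Φ′(ζ)`, `s = √−6 = (ζ³ + ζ⁹)(ζ² + ζ²²)`, `θ = ζ + ζ⁻¹` (Euler evaluation). research route conditional on HC_CM; not a corollary; Q11.4-sentence-2 already refuted in dim ≥ 3. [folklore] -/
theorem trace_xi_sqrtNegSix_five [IsCyclotomicExtension {24} ℚ K] (hζ : IsPrimitiveRoot ζ 24) :
    Algebra.trace ℚ K ((ζ ^ 3 * (aeval ζ (derivative (cyclotomic 24 ℚ)))⁻¹) * ((ζ ^ 3 + ζ ^ 9) * (ζ ^ 2 + ζ ^ 22)) * (ζ + ζ⁻¹) ^ 5) = 38 := by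
  have h24 : ζ ^ 24 = 1 := hζ.pow_eq_one
  have hΦ := cyc_twentyFour hζ
  rw [trace_of_key hζ (C (0 : ℚ) + C (-33 : ℚ) * X + C (0 : ℚ) * X ^ 2 + C (-19 : ℚ) * X ^ 3 + C (0 : ℚ) * X ^ 4 +
      C (33 : ℚ) * X ^ 5 + C (0 : ℚ) * X ^ 6 + C (38 : ℚ) * X ^ 7) (by compute_degree) (by
    rw [aeval_poly₈]
    push_cast
    linear_combination ((aeval ζ (derivative (cyclotomic 24 ℚ)))⁻¹ * (1 + 2 * ζ^4 + 38 * ζ^6 + 31 * ζ^8 + 21 * ζ^10 + 11 * ζ^12 +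
        5 * ζ^14)) * hΦ +
      ((aeval ζ (derivative (cyclotomic 24 ℚ)))⁻¹ * (1 + ζ^4 + 5 * ζ^6 + 10 * ζ^8 + 11 * ζ^10 + 10 * ζ^12 +
        11 * ζ^14 + 10 * ζ^16 + 5 * ζ^18 + ζ^20)) * h24)]
  norm_num [coeff_X_pow, coeff_X, coeff_C, coeff_one]

/-- `Tr(ζ′sθ^6) = 0` for `ζ′ = ξ = ζ³/Φ′(ζ)`, `s = √−6 = (ζ³ + ζ⁹)(ζ² + ζ²²)`, `θ = ζ + ζ⁻¹` (Euler evaluation). research route conditional on HC_CM; not a corollary; Q11.4-sentence-2 already refuted in dim ≥ 3. [folklore] -/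
theorem trace_xi_sqrtNegSix_six [IsCyclotomicExtension {24} ℚ K] (hζ : IsPrimitiveRoot ζ 24) :
    Algebra.trace ℚ K ((ζ ^ 3 * (aeval ζ (derivative (cyclotomic 24 ℚ)))⁻¹) * ((ζ ^ 3 + ζ ^ 9) * (ζ ^ 2 + ζ ^ 22)) * (ζ + ζ⁻¹) ^ 6) = 0 := by
  have h24 : ζ ^ 24 = 1 := hζ.pow_eq_one
  have hΦ := cyc_twentyFour hζ
  rw [trace_of_key hζ (C (-71 : ℚ) + C (0 : ℚ) * X + C (-52 : ℚ) * X ^ 2 + C (0 : ℚ) * X ^ 3 + C (52 : ℚ) * X ^ 4 +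
      C (0 : ℚ) * X ^ 5 + C (71 : ℚ) * X ^ 6 + C (0 : ℚ) * X ^ 7) (by compute_degree) (by
    rw [aeval_poly₈]
    push_cast
    linear_combination ((aeval ζ (derivative (cyclotomic 24 ℚ)))⁻¹ * (6 + ζ^2 + 7 * ζ^4 + 78 * ζ^6 + 69 * ζ^8 + 52 * ζ^10 +
        27 * ζ^12 + 16 * ζ^14)) * hΦ +
      ((aeval ζ (derivative (cyclotomic 24 ℚ)))⁻¹ * (6 + ζ^2 + ζ^4 + 6 * ζ^6 + 15 * ζ^8 + 21 * ζ^10 +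
        21 * ζ^12 + 21 * ζ^14 + 21 * ζ^16 + 15 * ζ^18 + 6 * ζ^20 + ζ^22)) * h24)]
  norm_num [coeff_X_pow, coeff_X, coeff_C, coeff_one]

/-- **The Gram datum `a` of `(E_ζ′, s)` in the real frame `θ^i` (`i < 4`)** for `ζ′ = ξ = ζ³/Φ′(ζ)` (principal type (1)),
`s = √−6 = (ζ³ + ζ⁹)(ζ² + ζ²²)`: the integer Hankel matrix `(−Tr(ζ′sθ^{i+j}))ᵢⱼ` (and `b = 0`, part 82 `hb_eq_zero`).
research route conditional on HC_CM; not a corollary; Q11.4-sentence-2 already refuted in dim ≥ 3. [cite: vanGeemen1994HodgeAV, Lemma 5.2 (2)–(3)] -/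
theorem realPart_xi_sqrtNegSix [IsCyclotomicExtension {24} ℚ K] [IsCMField K] (hζ : IsPrimitiveRoot ζ 24)
    {x : Fin 4 → K} (hx : ∀ i, x i = (ζ + ζ⁻¹) ^ (i : ℕ)) {a : Matrix (Fin 4) (Fin 4) ℚ}
    (ha : ∀ i j, a i j = Algebra.trace ℚ K ((ζ ^ 3 * (aeval ζ (derivative (cyclotomic 24 ℚ)))⁻¹) * x i * IsCMField.complexConj K (((ζ ^ 3 + ζ ^ 9) * (ζ ^ 2 + ζ ^ 22)) * x j))) :
    a = !![0, -2, 0, -10; -2, 0, -10, 0; 0, -10, 0, -38; -10, 0, -38, 0] := by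
  rw [ha_eq (complexConj_sqrtNegSix hζ) (complexConj_thetaFrame hζ hx) ha]
  ext i j
  simp only [Matrix.of_apply, hx, ← pow_add]
  fin_cases i <;> fin_cases j <;> simp [trace_xi_sqrtNegSix_zero hζ, trace_xi_sqrtNegSix_one hζ, trace_xi_sqrtNegSix_two hζ, trace_xi_sqrtNegSix_three hζ, trace_xi_sqrtNegSix_four hζ, trace_xi_sqrtNegSix_five hζ, trace_xi_sqrtNegSix_six hζ]

/-- **`det a = 576`** for `ζ′ = ξ = ζ³/Φ′(ζ)`, `s = √−6 = (ζ³ + ζ⁹)(ζ² + ζ²²)` (frame `θ^i`). research route conditional on HC_CM; not a corollary; Q11.4-sentence-2 already refuted in dim ≥ 3. [cite: vanGeemen1994HodgeAV, Lemma 5.2 (3)] -/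
theorem det_realPart_xi_sqrtNegSix [IsCyclotomicExtension {24} ℚ K] [IsCMField K] (hζ : IsPrimitiveRoot ζ 24)
    {x : Fin 4 → K} (hx : ∀ i, x i = (ζ + ζ⁻¹) ^ (i : ℕ)) {a : Matrix (Fin 4) (Fin 4) ℚ}
    (ha : ∀ i j, a i j = Algebra.trace ℚ K ((ζ ^ 3 * (aeval ζ (derivative (cyclotomic 24 ℚ)))⁻¹) * x i * IsCMField.complexConj K (((ζ ^ 3 + ζ ^ 9) * (ζ ^ 2 + ζ ^ 22)) * x j))) :
    a.det = 576 := by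
  rw [realPart_xi_sqrtNegSix hζ hx ha]
  simp [Matrix.det_succ_row_zero, Fin.sum_univ_succ, Fin.succAbove, Matrix.submatrix]
  norm_num

/-! ### §2 Invariance and class -/

/-- **For EVERY skew `ζ′` of PRINCIPAL type on `ℤ[ζ_24]` (`IsOfType 1 ζ′ ⊤`; `ζ′ = uξ`, `u` a real unit, `N(u) = 1`
by THEOREM L (i) at `24`) the Gram determinant of `(E_ζ′, s₆)` in the frame `θ^i` is `576`** — for every `Φ` and
every `Φ`-positive such `ζ′` (they exist on every `s₆`-balanced `Φ`: the census YES row, part 75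
`exists_principal_twentyFour_…`): the SPLIT row W4.6.1 `= (2, ℚ(√−6), 1)`; `(−1)² det a > 0`, the right sign for Weil signature `(2,2)` [vG94 5.2 (4)].
research route conditional on HC_CM; not a corollary; Q11.4-sentence-2 already refuted in dim ≥ 3. [cite: vanGeemen1994HodgeAV, Lemma 5.2 (3)–(4) and (5.4.1)] [cite: Shimura1998, §14.3 Prop. 5, p. 104] -/
theorem det_realPart_principal_sqrtNegSix [IsCyclotomicExtension {24} ℚ K] [IsCMField K]
    (hζ : IsPrimitiveRoot ζ 24) {ζ' : K} (hζ' : IsCMField.complexConj K ζ' = -ζ')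
    (hT : CMTypeLattice.IsOfType (1 : (FractionalIdeal (𝓞 K)⁰ K)ˣ) ζ' ⊤)
    {x : Fin 4 → K} (hx : ∀ i, x i = (ζ + ζ⁻¹) ^ (i : ℕ)) {a : Matrix (Fin 4) (Fin 4) ℚ}
    (ha : ∀ i j, a i j = Algebra.trace ℚ K (ζ' * x i * IsCMField.complexConj K (((ζ ^ 3 + ζ ^ 9) * (ζ ^ 2 + ζ ^ 22)) * x j))) :
    a.det = 576 := by
  obtain ⟨ωb, hωb⟩ := exists_basis_thetaPow hζ
  have hx' : ∀ i, x i = (ωb i : K) := fun i => (hx i).trans (hωb i).symm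
  rw [det_realPart_eq_of_isOfType ωb (complexConj_sqrtNegSix hζ) hx' (norm_realUnits_pos_twentyFour hζ)
    (complexConj_xi_twentyFour hζ) (xi_ne_zero hζ 3) hζ' (isOfType_one_xi_top hζ 3) hT (fun i j => rfl) ha]
  exact det_realPart_xi_sqrtNegSix hζ hx (fun i j => rfl)

/-- **`[576] = [1]`, the SPLIT class, in `ℚˣ/Nm(ℚ(√−6)ˣ)`** (`576 = 24² + 6·0²`): the principally polarised Weil-type
`ℤ[ζ_24]`-fourfolds for `ℚ(√−6)` lie on the SPLIT component — the SPLIT row W4.6.1 `= (2, ℚ(√−6), 1)` (the census's (F3) «`𝒪_K`-linear + principal ⟹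
split» for these CM points, as a kernel theorem).
research route conditional on HC_CM; not a corollary; Q11.4-sentence-2 already refuted in dim ≥ 3. [cite: vanGeemen1994HodgeAV, 5.4 and (5.4.1)] -/
theorem mk0_det_principal_sqrtNegSix :
    (QuotientGroup.mk (Units.mk0 (576 : ℚ) (by norm_num)) : weilNormResidueGroup 6) = splitDiscriminantClass 2 6 :=
  mk_eq_split_of_even (by decide) _ (mem_normUnitsSubgroup_of_sq_add_mul_sq _ (24 : ℚ) (0 : ℚ) (by norm_num))

end Summit.HodgeConjecture.Ring2WeilCoverage.WeilGramLevel24SqrtNegSix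

end
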